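import Mathlib
import Summits.Ventures.PercRepro2.CoinCoreGate
import Summits.Ventures.PercRepro2.CoinOrTailKDefs
import Summits.Ventures.PercRepro2.CoinChainTower
import Summits.Ventures.PercRepro2.CoinTowerClose

/-!
# Both markers at tower vertices: the FUNNEL — row 2′DARC over ANY core
(blind cell PercRepro2, night-2 g18; proofs/NIGHT2-DARC.md §58.10)

A SURE-coin OR-tower over ANY closed-in core `U` (no log-supermodularity), the free-arc vertex
`a` on top (sure coins), and a tower vertex `v` through which every route into `a` passes (the
entries of the levels above `v` and of `a` lie outside the lower tower core: a FUNNEL at `v`).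
Markers `(v, a)`.  With sure coins the whole tower is the deterministic closure `clSet` of the
level of `U` (`OrTower.sum_close` applied to the tower with `a` appended), the marker
`1[a ∈ S⁺]` is below `1[v ∈ S⁺]` (`clSet_funnel`), and the gate equals the `R`-law where `a` is
not reached; the abstract **`nested_functional_nonneg`** (`y ≤ x`, `G' = G` off `{y = 1}` ⟹
`T = (Λ − Λ₁)·[M₁₁·(Λ − Λ₂) + Λ₂²] ≥ 0`) closes: **`darc_of_towerFunnel`**, the general form of
`darc_of_chainMarkerAA'` (§57.10: the chain `a' → a` with the markers `(a', a)`).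
-/

namespace Summit.Ventures.PercRepro2.Coin

open Classical

section TowerAppend

variable {V : Type*} {E : Type*} [Fintype V] [DecidableEq V] [Fintype E] [DecidableEq E]
  {R : Type*} [Field R] [LinearOrder R] [IsStrictOrderedRing R]
  {arcs : E → Finset (V × V)} {s : V}

omit [Fintype V] [Fintype E] [DecidableEq E] [Field R] [LinearOrder R] [IsStrictOrderedRing R] in
/-- The tower core of an appended list. -/
lemma towerCore_append : ∀ (L₁ L₂ : List (Finset V × (V → E) × V)) (U : Finset V),
    towerCore U (L₁ ++ L₂) = towerCore (towerCore U L₁) L₂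
  | [], _, _ => rfl
  | x :: rest, L₂, U => by
      simp only [List.cons_append, towerCore]
      exact towerCore_append rest L₂ (insert x.2.2 U)

omit [Fintype V] [Fintype E] [DecidableEq E] [Field R] [LinearOrder R] [IsStrictOrderedRing R] in
/-- A tower vertex lies in the tower core. -/
lemma vertex_mem_towerCore : ∀ (L : List (Finset V × (V → E) × V)) (U : Finset V),
    ∀ x ∈ L, x.2.2 ∈ towerCore U L
  | [], _, _, hx => absurd hx List.not_mem_nil
  | y :: rest, U, x, hx => by
      simp only [towerCore]
      rw [List.mem_cons] at hx
      rcases hx with rfl | hx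
      · exact (subset_towerCore _ rest) (Finset.mem_insert_self _ _)
      · exact vertex_mem_towerCore rest _ x hx

omit [Fintype V] [Fintype E] [DecidableEq E] [Field R] [LinearOrder R] [IsStrictOrderedRing R] in
/-- Towers append. -/
lemma OrTower.append {U : Finset V} {L₁ L₂ : List (Finset V × (V → E) × V)}
    (h₁ : OrTower arcs s U L₁) (h₂ : OrTower arcs s (towerCore U L₁) L₂) :
    OrTower arcs s U (L₁ ++ L₂) := by
  induction h₁ with
  | nil U => exact h₂
  | cons U ent c v rest h _ ih =>
    simp only [List.cons_append]
    exact OrTower.cons _ _ _ _ _ h (ih h₂)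

end TowerAppend

section CloseMore

variable {V : Type*} {E : Type*} [DecidableEq V]

/-- The closure along an appended list. -/
lemma clSet_append : ∀ (L₁ L₂ : List (Finset V × (V → E) × V)) (W : Finset V),
    clSet (L₁ ++ L₂) W = clSet L₂ (clSet L₁ W)
  | [], _, _ => rfl
  | x :: rest, L₂, W => by
      simp only [List.cons_append, clSet]
      exact clSet_append rest L₂ _

/-- A level lies in its closure. -/
lemma subset_clSet : ∀ (L : List (Finset V × (V → E) × V)) (W : Finset V), W ⊆ clSet L W
  | [], _ => le_rfl
  | x :: rest, W => by
      simp only [clSet]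
      refine Finset.Subset.trans ?_ (subset_clSet rest _)
      split_ifs
      · exact Finset.subset_union_left
      · exact le_rfl

/-- A level missing every entry of every listed vertex is closed. -/
lemma clSet_eq_of_no_entry : ∀ (L : List (Finset V × (V → E) × V)) (W : Finset V),
    (∀ x ∈ L, ∀ r ∈ x.1, r ∉ W) → clSet L W = W
  | [], _, _ => rfl
  | x :: rest, W, hW => by
      simp only [clSet]
      rw [if_neg, clSet_eq_of_no_entry rest W (fun y hy => hW y (List.mem_cons_of_mem _ hy))]
      rintro ⟨r, hr, hrW⟩
      exact hW x List.mem_cons_self r hr hrW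

end CloseMore

section Nested

variable {V : Type*} [DecidableEq V] {R : Type*} [Field R] [LinearOrder R] [IsStrictOrderedRing R]

omit [DecidableEq V] in
/-- **The nested-marker functional is nonnegative for ANY pair of laws**: if the second marker is
below the first (`y ≤ x`, both `{0,1}`-valued) and the gate equals the `R`-law wherever the second
marker vanishes, then `T = (Λ − Λ₁)·[M₁₁·(Λ − Λ₂) + Λ₂²] ≥ 0` — no log-supermodularity at all. -/
theorem nested_functional_nonneg (U : Finset V) (G G' x y : Finset V → R)
    (hG : ∀ W, 0 ≤ G W) (hG' : ∀ W, 0 ≤ G' W)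
    (hx01 : ∀ W, x W = 0 ∨ x W = 1) (hy01 : ∀ W, y W = 0 ∨ y W = 1)
    (hyx : ∀ W ∈ U.powerset, y W ≤ x W) (h0 : ∀ W ∈ U.powerset, y W = 0 → G' W = G W) :
    0 ≤ (∑ W ∈ U.powerset, G W) ^ 2 * (∑ W ∈ U.powerset, G' W * (x W * y W))
        - (∑ W ∈ U.powerset, G W) * (∑ W ∈ U.powerset, G W * x W) *
          (∑ W ∈ U.powerset, G' W * y W)
        - (∑ W ∈ U.powerset, G W) * (∑ W ∈ U.powerset, G W * y W) *
          (∑ W ∈ U.powerset, G' W * x W)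
        + (∑ W ∈ U.powerset, G W * x W) * (∑ W ∈ U.powerset, G W * y W) *
          (∑ W ∈ U.powerset, G' W) := by
  -- pointwise facts
  have hxy : ∀ W ∈ U.powerset, x W * y W = y W := by
    intro W hW
    rcases hy01 W with hy | hy
    · rw [hy, mul_zero]
    · have := hyx W hW; rw [hy] at this ⊢
      rcases hx01 W with hx | hx
      · rw [hx] at this; norm_num at this
      · rw [hx, one_mul]
  have hGx : ∀ W ∈ U.powerset, G' W * x W = G W * (x W - y W) + G' W * y W := by
    intro W hW
    rcases hy01 W with hy | hy
    · rw [h0 W hW hy, hy]; ring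
    · have := hyx W hW; rw [hy] at this ⊢
      rcases hx01 W with hx | hx
      · rw [hx] at this; norm_num at this
      · rw [hx]; ring
  have hG1 : ∀ W ∈ U.powerset, G' W = G W * (1 - y W) + G' W * y W := by
    intro W hW
    rcases hy01 W with hy | hy
    · rw [h0 W hW hy, hy]; ring
    · rw [hy]; ring
  -- the three gate sums
  have eM₂ : ∑ W ∈ U.powerset, G' W * y W = ∑ W ∈ U.powerset, G' W * (x W * y W) :=
    Finset.sum_congr rfl fun W hW => by rw [hxy W hW]
  have eM₁ : ∑ W ∈ U.powerset, G' W * x W =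
      (∑ W ∈ U.powerset, G W * x W - ∑ W ∈ U.powerset, G W * y W) +
        ∑ W ∈ U.powerset, G' W * (x W * y W) := by
    calc ∑ W ∈ U.powerset, G' W * x W
        = ∑ W ∈ U.powerset, (G W * (x W - y W) + G' W * y W) :=
          Finset.sum_congr rfl fun W hW => hGx W hW
      _ = ∑ W ∈ U.powerset, G W * (x W - y W) + ∑ W ∈ U.powerset, G' W * y W :=
          Finset.sum_add_distrib
      _ = _ := by
          rw [eM₂, ← Finset.sum_sub_distrib]
          congr 1
          exact Finset.sum_congr rfl fun W _ => by ring
  have eM : ∑ W ∈ U.powerset, G' W =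
      (∑ W ∈ U.powerset, G W - ∑ W ∈ U.powerset, G W * y W) +
        ∑ W ∈ U.powerset, G' W * (x W * y W) := by
    calc ∑ W ∈ U.powerset, G' W
        = ∑ W ∈ U.powerset, (G W * (1 - y W) + G' W * y W) :=
          Finset.sum_congr rfl fun W hW => hG1 W hW
      _ = ∑ W ∈ U.powerset, G W * (1 - y W) + ∑ W ∈ U.powerset, G' W * y W :=
          Finset.sum_add_distrib
      _ = _ := by
          rw [eM₂, ← Finset.sum_sub_distrib]
          congr 1
          exact Finset.sum_congr rfl fun W _ => by ring
  rw [eM₂, eM₁, eM]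
  -- the bounds
  have hx1 : ∀ W, x W ≤ 1 := fun W => by rcases hx01 W with h | h <;> simp [h]
  have hy1 : ∀ W, y W ≤ 1 := fun W => by rcases hy01 W with h | h <;> simp [h]
  have hx0 : ∀ W, 0 ≤ x W := fun W => by rcases hx01 W with h | h <;> simp [h]
  have hy0 : ∀ W, 0 ≤ y W := fun W => by rcases hy01 W with h | h <;> simp [h]
  have hΛ₁ : ∑ W ∈ U.powerset, G W * x W ≤ ∑ W ∈ U.powerset, G W :=
    Finset.sum_le_sum fun W _ => by
      calc G W * x W ≤ G W * 1 := mul_le_mul_of_nonneg_left (hx1 W) (hG W)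
        _ = G W := mul_one _
  have hΛ₂ : ∑ W ∈ U.powerset, G W * y W ≤ ∑ W ∈ U.powerset, G W :=
    Finset.sum_le_sum fun W _ => by
      calc G W * y W ≤ G W * 1 := mul_le_mul_of_nonneg_left (hy1 W) (hG W)
        _ = G W := mul_one _
  have hM₁₁ : 0 ≤ ∑ W ∈ U.powerset, G' W * (x W * y W) :=
    Finset.sum_nonneg fun W _ => mul_nonneg (hG' W) (mul_nonneg (hx0 W) (hy0 W))
  have key : ∀ Λ Λ₁ Λ₂ M₁₁ : R,
      Λ ^ 2 * M₁₁ - Λ * Λ₁ * M₁₁ - Λ * Λ₂ * ((Λ₁ - Λ₂) + M₁₁) + Λ₁ * Λ₂ * ((Λ - Λ₂) + M₁₁) =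
        (Λ - Λ₁) * (M₁₁ * (Λ - Λ₂) + Λ₂ ^ 2) := by intros; ring
  rw [key]
  exact mul_nonneg (sub_nonneg.2 hΛ₁)
    (add_nonneg (mul_nonneg hM₁₁ (sub_nonneg.2 hΛ₂)) (sq_nonneg _))

end Nested

section TowerFunnel

variable {V : Type*} {E : Type*} [Fintype V] [DecidableEq V] [Fintype E] [DecidableEq E]
  {R : Type*} [Field R] [LinearOrder R] [IsStrictOrderedRing R]
  {arcs : E → Finset (V × V)} {s : V} {U : Finset V} {ent entv : Finset V} {c cv : V → E}
  {a v w : V} {low up : List (Finset V × (V → E) × V)}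

omit [Fintype V] [Fintype E] [DecidableEq E] [Field R] [LinearOrder R] [IsStrictOrderedRing R] in
/-- **The funnel**: if every entry of the levels above `v` and of `a` lies outside the lower tower
core, then `a` is in the closure of a level of `U` only if `v` is. -/
lemma clSet_funnel (hcovL : ∀ x ∈ up, ∀ r ∈ x.1, r ∉ towerCore U low)
    (hcov : ∀ r ∈ ent, r ∉ towerCore U low) (haU : a ∉ insert v (towerCore U low)) {W : Finset V} (hW : W ⊆ U)
    (ha : a ∈ clSet ((low ++ (entv, cv, v) :: up) ++ [(ent, c, a)]) W) :
    v ∈ clSet ((low ++ (entv, cv, v) :: up) ++ [(ent, c, a)]) W := by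
  rw [clSet_append, clSet_append] at ha ⊢
  simp only [clSet] at ha ⊢
  set W₁ : Finset V := if ∃ r ∈ entv, r ∈ clSet low W then clSet low W ∪ {v} else clSet low W
    with hW₁
  have hW₁sub : W₁ ⊆ insert v (towerCore U low) := by
    have h0 := clSet_subset_towerCore low U W hW
    simp only [hW₁]
    split_ifs
    · intro z hz
      rcases Finset.mem_union.1 hz with h | h
      · exact Finset.mem_insert_of_mem (h0 h)
      · rw [Finset.mem_singleton] at h; rw [h]; exact Finset.mem_insert_self _ _
    · exact h0.trans (Finset.subset_insert _ _)
  by_contra hv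
  -- `v ∉ W₁` (else `v` would be in the closure)
  have hvW₁ : v ∉ W₁ := by
    intro hmem
    apply hv
    have h1 : W₁ ⊆ clSet up W₁ := subset_clSet up W₁
    have h2 : clSet up W₁ ⊆
        (if ∃ r ∈ ent, r ∈ clSet up W₁ then clSet up W₁ ∪ {a} else clSet up W₁) := by
      split_ifs
      · exact Finset.subset_union_left
      · exact le_rfl
    exact h2 (h1 hmem)
  have hW₁low : W₁ ⊆ towerCore U low := by
    intro z hz
    rcases Finset.mem_insert.1 (hW₁sub hz) with h | h
    · exact absurd (h ▸ hz) hvW₁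
    · exact h
  -- nothing above `v` is reached
  have hfix : clSet up W₁ = W₁ :=
    clSet_eq_of_no_entry up W₁ fun x hx r hr hrW => hcovL x hx r hr (hW₁low hrW)
  rw [hfix] at ha
  have hno : ¬ ∃ r ∈ ent, r ∈ W₁ := by
    rintro ⟨r, hr, hrW⟩
    exact hcov r hr (hW₁low hrW)
  rw [if_neg hno] at ha
  exact haU (hW₁sub ha)

omit [Fintype V] in
/-- **THEOREM (both markers at tower vertices, the FUNNEL, ANY core).** A SURE-coin OR-tower
`low`, a SURE-coin OR-vertex `v` of its core, a SURE-coin OR-tower `up` above `v` and a SURE-coin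
OR-vertex `a` on top, over a closed-in core `U` with NO log-supermodularity; every entry of the
levels above `v` and of `a` lies outside the lower tower core (every route into `a` passes through
`v`); `t, w ∉ insert a (towerCore (insert v (towerCore U low)) up)`, `t, w ≠ s` ⟹
`DARC pr arcs s {t} v a a w`. -/
theorem darc_of_towerFunnel (pr : E → R) (hp : IsProbVec pr) (hS : SameEnds arcs)
    (hL : OrTower arcs s U low) (hsureL : ∀ x ∈ low, ∀ r ∈ x.1, pr (x.2.1 r) = 1)
    (hv : OrTailK arcs s (towerCore U low) entv cv v) (hsurev : ∀ r ∈ entv, pr (cv r) = 1)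
    (hup : OrTower arcs s (insert v (towerCore U low)) up)
    (hsureUp : ∀ x ∈ up, ∀ r ∈ x.1, pr (x.2.1 r) = 1)
    (h : OrTailK arcs s (towerCore (insert v (towerCore U low)) up) ent c a)
    (hsure : ∀ r ∈ ent, pr (c r) = 1)
    (hcovL : ∀ x ∈ up, ∀ r ∈ x.1, r ∉ towerCore U low) (hcov : ∀ r ∈ ent, r ∉ towerCore U low)
    {t : V} (htC : t ∉ insert a (towerCore (insert v (towerCore U low)) up)) (hts : t ≠ s)
    (hws : w ≠ s) (hwC : w ∉ insert a (towerCore (insert v (towerCore U low)) up)) :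
    DARC pr arcs s {t} v a a w := by
  have hC := h.closedInCoreU
  -- the full tower with `a` on top, over `U`
  have hcoreT : towerCore U (low ++ (entv, cv, v) :: up) =
      towerCore (insert v (towerCore U low)) up := by
    rw [towerCore_append]; rfl
  have hT : OrTower arcs s U (low ++ (entv, cv, v) :: up) :=
    hL.append (OrTower.cons _ _ _ _ _ hv hup)
  have hTall : OrTower arcs s U ((low ++ (entv, cv, v) :: up) ++ [(ent, c, a)]) := by
    refine hT.append ?_
    rw [hcoreT]
    exact OrTower.cons _ _ _ _ _ h (OrTower.nil _)
  have hcore : towerCore U ((low ++ (entv, cv, v) :: up) ++ [(ent, c, a)]) =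
      insert a (towerCore (insert v (towerCore U low)) up) := by
    rw [towerCore_append, hcoreT]; rfl
  have hsureAll : ∀ x ∈ (low ++ (entv, cv, v) :: up) ++ [(ent, c, a)], ∀ r ∈ x.1,
      pr (x.2.1 r) = 1 := by
    intro x hx
    rcases List.mem_append.1 hx with hx | hx
    · rcases List.mem_append.1 hx with hx | hx
      · exact hsureL x hx
      · rw [List.mem_cons] at hx
        rcases hx with rfl | hx
        · exact hsurev
        · exact hsureUp x hx
    · rw [List.mem_singleton] at hx; subst hx; exact hsure
  -- memberships
  have hvT : v ∈ towerCore (insert v (towerCore U low)) up :=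
    subset_towerCore _ up (Finset.mem_insert_self _ _)
  have hvC : v ∈ insert a (towerCore (insert v (towerCore U low)) up) :=
    Finset.mem_insert_of_mem hvT
  have haC : a ∈ insert a (towerCore (insert v (towerCore U low)) up) := Finset.mem_insert_self _ _
  have haU : a ∉ insert v (towerCore U low) := fun hmem => h.a_notin (subset_towerCore _ up hmem)
  unfold DARC
  rw [hC.phiC_gate_eq pr hS htC hts hvC haC haC hws hwC, ← hcore]
  set Tall := (low ++ (entv, cv, v) :: up) ++ [(ent, c, a)] with hTalldef
  set A : Finset V → R := fun X => prob pr (coreAvoidEvent arcs s t (towerCore U Tall) X)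
    with hAdef
  -- the seven sums through the closure
  have eΛ := hTall.sum_close pr hsureAll A
  have eFa := hTall.sum_close pr hsureAll (fun X => A X * (if v ∈ X then (1 : R) else 0))
  have eFb := hTall.sum_close pr hsureAll (fun X => A X * (if a ∈ X then (1 : R) else 0))
  have eM := hTall.sum_close pr hsureAll (fun X => A (starTarget a w X))
  have eX := hTall.sum_close pr hsureAll
    (fun X => A (starTarget a w X) * (if v ∈ X then (1 : R) else 0))
  have eY := hTall.sum_close pr hsureAll
    (fun X => A (starTarget a w X) * (if a ∈ X then (1 : R) else 0))
  have eXY := hTall.sum_close pr hsureAll (fun X => A (starTarget a w X) *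
    ((if v ∈ X then (1 : R) else 0) * (if a ∈ X then (1 : R) else 0)))
  beta_reduce at eΛ eFa eFb eM eX eY eXY
  have assoc : ∀ (C : Finset V) (F m : Finset V → R),
      (∑ X ∈ C.powerset, prob pr (coreLevel arcs s C X) * F X * m X) =
        ∑ X ∈ C.powerset, prob pr (coreLevel arcs s C X) * (F X * m X) :=
    fun C F m => Finset.sum_congr rfl fun X _ => mul_assoc _ _ _
  rw [assoc _ A (fun X => if v ∈ X then (1 : R) else 0),
    assoc _ A (fun X => if a ∈ X then (1 : R) else 0),
    assoc _ (fun X => A (starTarget a w X)) (fun X => if v ∈ X then (1 : R) else 0),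
    assoc _ (fun X => A (starTarget a w X)) (fun X => if a ∈ X then (1 : R) else 0),
    assoc _ (fun X => A (starTarget a w X))
      (fun X => (if v ∈ X then (1 : R) else 0) * (if a ∈ X then (1 : R) else 0))]
  rw [eΛ, eFa, eFb, eM, eX, eY, eXY]
  have assoc' : ∀ (F m : Finset V → R),
      (∑ W ∈ U.powerset, prob pr (coreLevel arcs s U W) * (F (clSet Tall W) * m (clSet Tall W))) =
        ∑ W ∈ U.powerset, prob pr (coreLevel arcs s U W) * F (clSet Tall W) * m (clSet Tall W) :=
    fun F m => Finset.sum_congr rfl fun W _ => (mul_assoc _ _ _).symm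
  rw [assoc' A (fun X => if v ∈ X then (1 : R) else 0),
    assoc' A (fun X => if a ∈ X then (1 : R) else 0),
    assoc' (fun X => A (starTarget a w X)) (fun X => if v ∈ X then (1 : R) else 0),
    assoc' (fun X => A (starTarget a w X)) (fun X => if a ∈ X then (1 : R) else 0),
    assoc' (fun X => A (starTarget a w X))
      (fun X => (if v ∈ X then (1 : R) else 0) * (if a ∈ X then (1 : R) else 0))]
  -- the nested-marker functional
  have hA0 : ∀ X, 0 ≤ A X := fun X => prob_nonneg hp _
  have hν0 : ∀ W, 0 ≤ prob pr (coreLevel arcs s U W) := fun W => prob_nonneg hp _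
  refine nested_functional_nonneg U (fun W => prob pr (coreLevel arcs s U W) * A (clSet Tall W))
    (fun W => prob pr (coreLevel arcs s U W) * A (starTarget a w (clSet Tall W)))
    (fun W => if v ∈ clSet Tall W then (1 : R) else 0)
    (fun W => if a ∈ clSet Tall W then (1 : R) else 0)
    (fun W => mul_nonneg (hν0 W) (hA0 _)) (fun W => mul_nonneg (hν0 W) (hA0 _))
    (fun W => by split_ifs <;> simp) (fun W => by split_ifs <;> simp) ?_ ?_
  · intro W hW
    have hWU : W ⊆ U := Finset.mem_powerset.1 hW
    by_cases ha : a ∈ clSet Tall W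
    · rw [if_pos ha, if_pos (clSet_funnel hcovL hcov haU hWU ha)]
    · rw [if_neg ha]; split_ifs <;> norm_num
  · intro W _ hy
    have ha : a ∉ clSet Tall W := by
      intro hmem
      rw [if_pos hmem] at hy
      exact one_ne_zero hy
    simp only [starTarget, if_neg ha]

end TowerFunnel

end Summit.Ventures.PercRepro2.Coin
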